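import Mathlib.Analysis.SpecialFunctions.Exponential
import Mathlib.Analysis.Complex.Exponential
import Mathlib.Algebra.BigOperators.Ring.Finset
import Mathlib.Algebra.GroupWithZero.Units.Fintype
import Mathlib.MeasureTheory.OuterMeasure.Basic
import Literature.Computability.QuantumComplexity.PlantedNoisyKXOR
import HarnessLib

/-!
# Planted Noisy `k`XOR: discharge of the named fact `SchmidhuberEtAl2025_thm418`

Sibling proof file of `PlantedNoisyKXOR.lean` (same namespace
`Literature.Computability.QuantumComplexity.KXOR`). It proves
`theorem SchmidhuberEtAl2025_thm418_holds : SchmidhuberEtAl2025_thm418` — the vendored special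
case of Schmidhuber–O'Donnell–Kothari–Babbush, *Quartic quantum speedups for planted inference*,
PRX 15 (2025) 021077 = arXiv:2406.19378 ("SOKB"), Theorem 4.18 — with no new named fact.

## Proof route, and what it says about the vendored statement

`HasQuantumSolver G k m̄ ρ gates qubits` (the conclusion of the fact) asks for a family of
`QCircuitAlg`s, i.e. for every size `n`, every instance `𝓘` and seed `r` SOME circuit over `G`
within the gate/qubit budget whose measured wire `0` answers Problem 2.6 with probability
`1 - o(1)`; the circuit may depend on `𝓘` arbitrarily (its docstring: "no uniformity is
asserted"; the fact's docstring: "No uniformity/preprocessing-time claim is part of this fact").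
Consequently the statement AS VENDORED is implied by plain STATISTICAL distinguishability of the
Poissonised random and planted ensembles at the Kikuchi threshold mean
`m̄(n) = C_κ (n/ℓ)^{(k-2)/2} · n`, which exceeds `A · n · ln n` for a constant `A = A(k, κ) > 0`
(`thresholdMean_ge`) — far above the information-theoretic threshold `Δ = m/n > 1` recalled in
SOKB §1.1 ("once `Δ > 1`, the two distributions can be distinguished, although not necessarily in
polynomial time"). We formalize the brute-force distinguisher the paper alludes to in §1.2 and
§2.1 ("we could hypothetically succeed by detecting whether `Opt ≈ 0` or `Opt ≈ ρ`"): answer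
"planted" iff some `x ∈ {±1}ⁿ` has correlation `∑_{(S,b) ∈ 𝓘} b x^S ≥ ρ m̄/2` (`plantedLike`), and
let the "quantum algorithm" be the one-qubit circuit writing that answer (`testAlg`: an `X` gate
for "random", the empty circuit for "planted"; one gate, one qubit, so every budget in the fact is
met with `C_g = C_q = 1`, `a_g = a_q = 0`). The error analysis is the paper's "standard Chernoff +
union bound" (cf. Prop. 2.15, Fact 2.5): under `𝓡̃` each `b x^S` is a fair sign, so
`P[∃ x, corr ≥ θ] ≤ 2ⁿ e^{-tθ} 𝔼_{m∼Poi(m̄)} (cosh t)^m ≤ 2ⁿ e^{-tθ + m̄ t²}`; under `𝓟̃^z` the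
correlation with `z` is `∑ ηᵢ` with `𝔼 ηᵢ = ρ`, so `P[corr z < θ] ≤ e^{tθ + m̄ (t² - tρ)}`; with
`θ = ρ m̄/2`, `t = ρ/4` both are `≤ 2ⁿ e^{-ρ² m̄/16} ≤ 1 - σ` from some `n₀` on because
`m̄ ≥ A n ln n`.

HONESTY NOTE for planners/refuters of the consumer route (QuantumAdvantage/ExponentLadder): this
discharge shows that `SchmidhuberEtAl2025_thm418`, being non-uniform, carries none of the
quantum-algorithmic content of the printed theorem (guided sparse Hamiltonian phase estimation on
the Kikuchi matrix, SOKB Thms. 4.6–4.17); a route that needs a genuine quantum upper bound must use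
`HasUniformQuantumSolver` with an explicit classical preprocessing bound. The printed Theorem 4.18
itself states no uniformity clause either, so the fact is a faithful (weak) special case, not a
misstatement.

## Contents

* `ev q F = ∑' a, q a * F a` and its calculus (`ev_bind`, `ev_map`, `ev_pure`, `ev_fintype`,
  `toOuterMeasure_eq_ev`, complements and real-valued averages);
* `iid_chernoff` — exponential Markov bound for `iidPMF` (independence as the finite identity
  `∑_f ∏ᵢ h(fᵢ) = (∑ₐ h a)^m`, `Finset.sum_pow'`);
* `hasSum_poisson_pgf`, `poisson_mixture_le` — `𝔼_{m∼Poi(r)} M^m = e^{r(M-1)}`;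
* `corrTerm`, `corr`, the per-constraint MGF bounds `ev_exp_uniformConstraint_le`
  (`cosh t ≤ 1 + t²`) and `ev_exp_plantedConstraint_le` (`≤ 1 - tρ + t²`), via
  `Real.abs_exp_sub_one_sub_id_le`;
* `plantedLike`, the four error bounds (`random_…`, `planted_…`, `poissonRandom_…`,
  `poissonPlanted_…`), `eventually_two_pow_mul_exp_le`, `thresholdMean_ge`;
* the answer circuits `flipCircuit` (`xGate` = permutation matrix of the bit flip, unitary by
  `permMatrix_mem_unitaryGroup`) and `idleCircuit`, the algorithm `testAlg`, and the discharge.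

## References

* A. Schmidhuber, R. O'Donnell, R. Kothari, R. Babbush, PRX 15 (2025) 021077 = arXiv:2406.19378:
  Thm. 4.18 (p. 28 of the arXiv text), Problem 2.6, Def. 2.2 and Fact 2.5, Prop. 2.15, §1.1–1.2.
* Folklore: Chernoff–Hoeffding method, Poisson probability generating function.
-/

noncomputable section

open scoped NNReal ENNReal Classical
open ProbabilityTheory MeasureTheory Finset

namespace Literature.Computability.QuantumComplexity

open Cryptography

namespace KXOR

/-! ## Expectations of `ℝ≥0∞`-valued functions under a `PMF` -/

section ev

variable {α β : Type*}

/-- `ev q F = ∑' a, q a * F a`: the expectation of an `ℝ≥0∞`-valued function under the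
probability mass function `q` (the lower Lebesgue integral against `q.toMeasure`, written as a
plain `tsum` so that no measurable structure is needed). [folklore] -/
def ev (q : PMF α) (F : α → ℝ≥0∞) : ℝ≥0∞ :=
  ∑' a, q a * F a

/-- The expectation of a constant. [folklore] -/
theorem ev_const (q : PMF α) (c : ℝ≥0∞) : ev q (fun _ => c) = c := by
  rw [ev, ENNReal.tsum_mul_right, q.tsum_coe, one_mul]

/-- Monotonicity of the expectation. [folklore] -/
theorem ev_mono {q : PMF α} {F G : α → ℝ≥0∞} (h : ∀ a, F a ≤ G a) : ev q F ≤ ev q G :=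
  ENNReal.tsum_le_tsum fun a => mul_le_mul_right (h a) _

/-- Constants come out of the expectation. [folklore] -/
theorem ev_mul_left (q : PMF α) (c : ℝ≥0∞) (F : α → ℝ≥0∞) :
    ev q (fun a => c * F a) = c * ev q F := by
  rw [ev, ev, ← ENNReal.tsum_mul_left]
  exact tsum_congr fun a => by rw [mul_left_comm]

/-- The expectation under a point mass. [folklore] -/
theorem ev_pure (a : α) (F : α → ℝ≥0∞) : ev (PMF.pure a) F = F a := by
  rw [ev, tsum_eq_single a]
  · rw [PMF.pure_apply_self, one_mul]
  · intro b hb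
    rw [PMF.pure_apply_of_ne _ _ hb, zero_mul]

/-- The expectation under a monadic bind is the iterated expectation. [folklore] -/
theorem ev_bind (p : PMF α) (f : α → PMF β) (F : β → ℝ≥0∞) :
    ev (p.bind f) F = ev p fun a => ev (f a) F := by
  unfold ev
  calc ∑' b, (p.bind f) b * F b = ∑' b, ∑' a, p a * (f a b * F b) := by
        refine tsum_congr fun b => ?_
        rw [PMF.bind_apply, ← ENNReal.tsum_mul_right]
        exact tsum_congr fun a => mul_assoc _ _ _
    _ = ∑' a, ∑' b, p a * (f a b * F b) := ENNReal.tsum_comm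
    _ = ∑' a, p a * ∑' b, f a b * F b := tsum_congr fun a => ENNReal.tsum_mul_left

/-- The expectation under a push-forward. [folklore] -/
theorem ev_map (p : PMF α) (g : α → β) (F : β → ℝ≥0∞) : ev (p.map g) F = ev p (F ∘ g) := by
  rw [← PMF.bind_pure_comp, ev_bind]
  exact congrArg _ (funext fun a => ev_pure _ _)

/-- Over a finite type the expectation is a finite sum. [folklore] -/
theorem ev_fintype [Fintype α] (q : PMF α) (F : α → ℝ≥0∞) : ev q F = ∑ a, q a * F a :=
  tsum_fintype _

/-- The (outer) measure of a set is the expectation of its indicator. [folklore] -/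
theorem toOuterMeasure_eq_ev (q : PMF α) (s : Set α) :
    q.toOuterMeasure s = ev q fun a => if a ∈ s then 1 else 0 := by
  rw [PMF.toOuterMeasure_apply, ev]
  refine tsum_congr fun a => ?_
  rw [Set.indicator_apply]
  split_ifs <;> simp

/-- A set and its complement have total mass `1`. [folklore] -/
theorem toOuterMeasure_add_compl (q : PMF α) (s : Set α) :
    q.toOuterMeasure s + q.toOuterMeasure sᶜ = 1 := by
  rw [PMF.toOuterMeasure_apply, PMF.toOuterMeasure_apply, ← ENNReal.tsum_add, ← q.tsum_coe]
  refine tsum_congr fun a => ?_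
  rw [← Pi.add_apply (s.indicator ⇑q), Set.indicator_self_add_compl]

/-- The mass of the complement, as a real number. [folklore] -/
theorem toReal_toOuterMeasure_compl (q : PMF α) (s : Set α) :
    (q.toOuterMeasure sᶜ).toReal = 1 - (q.toOuterMeasure s).toReal := by
  have h := toOuterMeasure_add_compl q s
  have hs : q.toOuterMeasure s ≠ ⊤ := ne_top_of_le_ne_top ENNReal.one_ne_top (h ▸ le_self_add)
  have : q.toOuterMeasure sᶜ = 1 - q.toOuterMeasure s :=
    ENNReal.eq_sub_of_add_eq hs (by rw [add_comm, h])
  rw [this, ENNReal.toReal_sub_of_le (h ▸ le_self_add) ENNReal.one_ne_top, ENNReal.toReal_one]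

/-- The real-weighted sum of an indicator is the mass of the set. [folklore] -/
theorem tsum_toReal_mul_indicator (q : PMF α) (s : Set α) :
    ∑' a, (q a).toReal * (if a ∈ s then (1 : ℝ) else 0) = (q.toOuterMeasure s).toReal := by
  rw [toOuterMeasure_eq_ev, ev, ENNReal.tsum_toReal_eq fun a => ?_]
  · refine tsum_congr fun a => ?_
    split_ifs <;> simp
  · exact ENNReal.mul_ne_top (PMF.apply_ne_top q a) (by split_ifs <;> simp)

/-- Lower bound for a real-weighted average by the mass of a set on which the integrand is at
least `1` (integrand nonnegative and bounded). [folklore] -/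
theorem toReal_toOuterMeasure_le_tsum (q : PMF α) (s : Set α) (F : α → ℝ) (K : ℝ)
    (h0 : ∀ a, 0 ≤ F a) (hK : ∀ a, F a ≤ K) (h1 : ∀ a ∈ s, 1 ≤ F a) :
    (q.toOuterMeasure s).toReal ≤ ∑' a, (q a).toReal * F a := by
  rw [← tsum_toReal_mul_indicator]
  refine Summable.tsum_le_tsum (fun a => ?_) ?_ ?_
  · refine mul_le_mul_of_nonneg_left ?_ ENNReal.toReal_nonneg
    split_ifs with ha
    · exact h1 a ha
    · exact h0 a
  · refine (ENNReal.summable_toReal q.tsum_coe_ne_top).of_nonneg_of_le (fun a => ?_)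
      (fun a => ?_)
    · exact mul_nonneg ENNReal.toReal_nonneg (by split_ifs <;> norm_num)
    · refine mul_le_of_le_one_right ENNReal.toReal_nonneg ?_
      split_ifs <;> norm_num
  · refine ((ENNReal.summable_toReal q.tsum_coe_ne_top).mul_left K).of_nonneg_of_le
      (fun a => ?_) (fun a => ?_)
    · exact mul_nonneg ENNReal.toReal_nonneg (h0 a)
    · rw [mul_comm K]; exact mul_le_mul_of_nonneg_left (hK a) ENNReal.toReal_nonneg

end ev

/-! ## Chernoff bound for sums of i.i.d. terms under `iidPMF` -/

section chernoff

variable {α : Type*} [Fintype α]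

/-- **Exponential Markov (Chernoff) bound for an i.i.d. product law.** For `t ≥ 0`,
`P_{f ∼ q^{⊗m}}[θ ≤ ∑ᵢ g(fᵢ)] ≤ e^{-tθ} · (𝔼_q e^{t g})^m`. (Markov's inequality applied to
`e^{t ∑ g}` and independence `𝔼 ∏ = ∏ 𝔼`, here the finite identity `∑_f ∏ᵢ h(fᵢ) = (∑ₐ h a)^m`.)
[folklore] -/
theorem iid_chernoff (q : PMF α) (m : ℕ) (g : α → ℝ) (θ t : ℝ) (ht : 0 ≤ t) :
    (iidPMF (ι := Fin m) q).toOuterMeasure {f | θ ≤ ∑ i, g (f i)} ≤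
      ENNReal.ofReal (Real.exp (-(t * θ))) *
        (ev q fun a => ENNReal.ofReal (Real.exp (t * g a))) ^ m := by
  rw [toOuterMeasure_eq_ev, ev_fintype]
  have key : ∀ f : Fin m → α,
      (iidPMF q f * if f ∈ {f : Fin m → α | θ ≤ ∑ i, g (f i)} then 1 else 0) ≤
        ENNReal.ofReal (Real.exp (-(t * θ))) *
          ∏ i, (q (f i) * ENNReal.ofReal (Real.exp (t * g (f i)))) := by
    intro f
    rw [Finset.prod_mul_distrib, ← iidPMF_apply,
      ← ENNReal.ofReal_prod_of_nonneg (fun i _ => (Real.exp_pos _).le), ← Real.exp_sum,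
      mul_left_comm, ← ENNReal.ofReal_mul (Real.exp_pos _).le, ← Real.exp_add]
    split_ifs with h
    · simp only [Set.mem_setOf_eq] at h
      rw [mul_one]
      conv_lhs => rw [← mul_one (iidPMF q f)]
      refine mul_le_mul_right ?_ _
      rw [← ENNReal.ofReal_one]
      refine ENNReal.ofReal_le_ofReal (Real.one_le_exp ?_)
      have : -(t * θ) + ∑ i, t * g (f i) = t * (∑ i, g (f i) - θ) := by
        rw [← Finset.mul_sum]; ring
      rw [this]
      exact mul_nonneg ht (sub_nonneg.2 h)
    · rw [mul_zero]
      exact zero_le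
  calc ∑ f, iidPMF q f * (if f ∈ {f : Fin m → α | θ ≤ ∑ i, g (f i)} then 1 else 0)
      ≤ ∑ f : Fin m → α, ENNReal.ofReal (Real.exp (-(t * θ))) *
          ∏ i, (q (f i) * ENNReal.ofReal (Real.exp (t * g (f i)))) :=
        Finset.sum_le_sum fun f _ => key f
    _ = ENNReal.ofReal (Real.exp (-(t * θ))) *
          (∑ a, q a * ENNReal.ofReal (Real.exp (t * g a))) ^ m := by
        rw [← Finset.mul_sum, Finset.sum_pow', Fintype.piFinset_univ]
    _ = _ := by rw [ev_fintype]

end chernoff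

/-! ## Poisson mixtures: `𝔼_{m ∼ Poi(r)} M^m = e^{r(M-1)}` -/

section poisson

/-- The probability generating function of the Poisson law:
`∑ₘ e^{-r} rᵐ/m! · aᵐ = e^{r(a-1)}`. [folklore] -/
theorem hasSum_poisson_pgf (r : ℝ≥0) (a : ℝ) :
    HasSum (fun m : ℕ => Real.exp (-r) * (r : ℝ) ^ m / (Nat.factorial m) * a ^ m)
      (Real.exp (r * (a - 1))) := by
  have h := (NormedSpace.expSeries_div_hasSum_exp ((r : ℝ) * a)).mul_left (Real.exp (-r))
  have e : NormedSpace.exp ((r : ℝ) * a) = Real.exp (r * a) := (congrFun Real.exp_eq_exp_ℝ _).symm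
  rw [e, ← Real.exp_add] at h
  have hfun : (fun m : ℕ => Real.exp (-r) * (r : ℝ) ^ m / (Nat.factorial m) * a ^ m) =
      fun m : ℕ => Real.exp (-r) * (((r : ℝ) * a) ^ m / (Nat.factorial m)) := by
    funext m
    rw [mul_pow]
    ring
  have hval : Real.exp (r * (a - 1)) = Real.exp (-(r : ℝ) + r * a) := by
    congr 1
    ring
  rw [hfun, hval]
  exact h

/-- Mixing a bound `B · Mᵐ` over `m ∼ Poi(r)` gives `B · e^{r(M-1)}` (in `ℝ≥0∞`). [folklore] -/
theorem poisson_mixture_le (r : ℝ≥0) {B M : ℝ} (hB : 0 ≤ B) (hM : 0 ≤ M) (u : ℕ → ℝ≥0∞)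
    (hu : ∀ m, u m ≤ ENNReal.ofReal (B * M ^ m)) :
    ∑' m, (poissonMeasure r).toPMF m * u m ≤ ENNReal.ofReal (B * Real.exp (r * (M - 1))) := by
  have hs := (hasSum_poisson_pgf r M).mul_right B
  calc ∑' m, (poissonMeasure r).toPMF m * u m
      ≤ ∑' m, ENNReal.ofReal (Real.exp (-r) * (r : ℝ) ^ m / (Nat.factorial m) * M ^ m * B) := by
        refine ENNReal.tsum_le_tsum fun m => ?_
        rw [Measure.toPMF_apply, poissonMeasure_singleton,
          show Real.exp (-r) * (r : ℝ) ^ m / (Nat.factorial m) * M ^ m * B =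
            (Real.exp (-r) * (r : ℝ) ^ m / (Nat.factorial m)) * (B * M ^ m) by ring,
          ENNReal.ofReal_mul (by positivity)]
        exact mul_le_mul_right (hu m) _
    _ = ENNReal.ofReal (∑' m, Real.exp (-r) * (r : ℝ) ^ m / (Nat.factorial m) * M ^ m * B) :=
        (ENNReal.ofReal_tsum_of_nonneg (fun m => by positivity) hs.summable).symm
    _ = ENNReal.ofReal (B * Real.exp (r * (M - 1))) := by rw [hs.tsum_eq, mul_comm]

end poisson

/-! ## Elementary exponential inequalities -/

section expineq

/-- The two-point moment generating function bound: for weights `p, p' ≥ 0` with `p + p' = 1`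
and `|t| ≤ 1`, `p e^{-t} + p' e^{t} ≤ 1 - t (p - p') + t²` (from `e^x ≤ 1 + x + x²` on `|x| ≤ 1`,
Mathlib's `Real.abs_exp_sub_one_sub_id_le`). [folklore] -/
theorem two_point_mgf_le {p p' t : ℝ} (hp : 0 ≤ p) (hp' : 0 ≤ p') (h1 : p + p' = 1)
    (ht : |t| ≤ 1) :
    p * Real.exp (-t) + p' * Real.exp t ≤ 1 - t * (p - p') + t ^ 2 := by
  have h₁ : Real.exp (-t) ≤ 1 + -t + (-t) ^ 2 := by
    have h := (abs_sub_le_iff.1 (Real.abs_exp_sub_one_sub_id_le (show |(-t)| ≤ 1 by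
      rwa [abs_neg]))).1
    linarith
  have h₂ : Real.exp t ≤ 1 + t + t ^ 2 := by
    have h := (abs_sub_le_iff.1 (Real.abs_exp_sub_one_sub_id_le ht)).1
    linarith
  have e1 := mul_le_mul_of_nonneg_left h₁ hp
  have e2 := mul_le_mul_of_nonneg_left h₂ hp'
  nlinarith

/-- `cosh`-type bound: `e^t + e^{-t} ≤ 2 (1 + t²)` for `|t| ≤ 1`. [folklore] -/
theorem exp_add_exp_neg_le {t : ℝ} (ht : |t| ≤ 1) : Real.exp t + Real.exp (-t) ≤ 2 * (1 + t ^ 2) := by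
  have h := two_point_mgf_le (p := 1 / 2) (p' := 1 / 2) (t := t) (by norm_num) (by norm_num)
    (by norm_num) ht
  linarith

end expineq

/-! ## The correlation statistic and the per-constraint moment generating functions -/

section mgf

variable {n k : ℕ}

/-- The summand `b · x^S ∈ {±1}` of the correlation of the assignment `x` with the constraint
`(S, b)`, as a real number. [cite: SchmidhuberEtAl2025, Def. 2.2] -/
def corrTerm (x : Fin n → ℤˣ) (c : Scope n k × ℤˣ) : ℝ :=
  ((c.2 * monomial x c.1.1 : ℤˣ) : ℤ)

/-- The CORRELATION `corr x 𝓘 = ∑_{(S,b) ∈ 𝓘} b · x^S = |𝓘| · adv_𝓘(x)` of an assignment with an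
instance (the numerator of the advantage of Def. 2.2). [cite: SchmidhuberEtAl2025, Def. 2.2] -/
def corr (x : Fin n → ℤˣ) (I : Instance n k) : ℝ :=
  (I.map (corrTerm x)).sum

/-- The correlation of a list given as `List.ofFn` is the finite sum of its terms. [folklore] -/
theorem corr_ofFn (x : Fin n → ℤˣ) {m : ℕ} (f : Fin m → Scope n k × ℤˣ) :
    corr x (List.ofFn f) = ∑ i, corrTerm x (f i) := by
  rw [corr, List.map_ofFn, Fin.sum_ofFn]
  rfl

/-- The expectation under a uniform law is bounded by bounding the plain sum. [folklore] -/
theorem ev_uniformOfFintype_le {α : Type*} [Fintype α] [Nonempty α] (F : α → ℝ≥0∞) (b : ℝ≥0∞)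
    (h : ∑ a, F a ≤ Fintype.card α * b) : ev (PMF.uniformOfFintype α) F ≤ b := by
  rw [ev_fintype]
  simp only [PMF.uniformOfFintype_apply]
  rw [← Finset.mul_sum]
  have h0 : (Fintype.card α : ℝ≥0∞) ≠ 0 := Nat.cast_ne_zero.2 Fintype.card_ne_zero
  have htop : (Fintype.card α : ℝ≥0∞) ≠ ⊤ := ENNReal.natCast_ne_top _
  calc (Fintype.card α : ℝ≥0∞)⁻¹ * ∑ a, F a ≤ (Fintype.card α : ℝ≥0∞)⁻¹ * (Fintype.card α * b) :=
        mul_le_mul_right h _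
    _ = b := ENNReal.inv_mul_cancel_left h0 htop

/-- **MGF of one uniformly random constraint.** For `|t| ≤ 1` and any assignment `x`,
`𝔼_{(S,b) uniform} e^{t · b x^S} = cosh t ≤ 1 + t²` (the sign `b` is a fair coin independent of
`S`). [folklore] -/
theorem ev_exp_uniformConstraint_le (h : k ≤ n) (x : Fin n → ℤˣ) {t : ℝ} (ht : |t| ≤ 1) :
    ev (uniformConstraint n k h) (fun c => ENNReal.ofReal (Real.exp (t * corrTerm x c))) ≤
      ENNReal.ofReal (1 + t ^ 2) := by
  haveI : Nonempty (Scope n k) := (nonempty_scope_iff n k).2 h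
  have inner : ∀ S : Scope n k,
      ∑ b : ℤˣ, ENNReal.ofReal (Real.exp (t * corrTerm x (S, b))) =
        ENNReal.ofReal (Real.exp t + Real.exp (-t)) := by
    intro S
    rw [UnitsInt.univ, Finset.sum_insert (by decide), Finset.sum_singleton,
      ← ENNReal.ofReal_add (Real.exp_pos _).le (Real.exp_pos _).le]
    have h1 : corrTerm x (S, 1) = (((monomial x S.1 : ℤˣ) : ℤ) : ℝ) := by simp [corrTerm]
    have h2 : corrTerm x (S, -1) = -(((monomial x S.1 : ℤˣ) : ℤ) : ℝ) := by simp [corrTerm]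
    rw [h1, h2]
    rcases Int.units_eq_one_or (monomial x S.1) with hm | hm
    · rw [hm]; simp
    · rw [hm]; simp [add_comm]
  have hb : Real.exp t + Real.exp (-t) ≤ 2 * (1 + t ^ 2) := exp_add_exp_neg_le ht
  refine ev_uniformOfFintype_le _ _ ?_
  rw [Fintype.sum_prod_type, Fintype.card_prod, Fintype.card_units_int, Nat.cast_mul]
  simp_rw [inner]
  rw [Finset.sum_const, Finset.card_univ, nsmul_eq_mul, mul_assoc]
  refine mul_le_mul_right ?_ _
  rw [Nat.cast_ofNat, ← ENNReal.ofReal_ofNat 2, ← ENNReal.ofReal_mul (by norm_num)]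
  exact ENNReal.ofReal_le_ofReal hb

/-- Under a planted constraint for the secret `z`, the correlation term with `z` itself is the
noise sign `η` (`b z^S = η z^S z^S = η`). [cite: SchmidhuberEtAl2025, Fact 2.5] -/
theorem corrTerm_planted (z : Fin n → ℤˣ) (S : Scope n k) (η : ℤˣ) :
    corrTerm z (S, η * monomial z S.1) = ((η : ℤˣ) : ℤ) := by
  unfold corrTerm
  rw [mul_assoc, Int.units_mul_self, mul_one]

/-- **MGF (lower tail) of one planted constraint against its own secret.** For `0 ≤ t ≤ 1` and
`ρ ∈ (0,1)`, `𝔼 e^{-t η} = ((1+ρ)/2) e^{-t} + ((1-ρ)/2) e^{t} ≤ 1 - tρ + t²`. [folklore] -/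
theorem ev_exp_plantedConstraint_le (h : k ≤ n) {ρ : ℝ} (hρ0 : 0 ≤ ρ) (hρ1 : ρ ≤ 1)
    (z : Fin n → ℤˣ) {t : ℝ} (ht : |t| ≤ 1) :
    ev (plantedConstraint n k h ρ z)
        (fun c => ENNReal.ofReal (Real.exp (-(t * corrTerm z c)))) ≤
      ENNReal.ofReal (1 - t * ρ + t ^ 2) := by
  haveI : Nonempty (Scope n k) := (nonempty_scope_iff n k).2 h
  -- the law of the noise sign
  set η' : ℝ := (1 - ρ) / 2 with hη'
  have hη0 : 0 ≤ η' := by rw [hη']; linarith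
  have hη1 : η' ≤ 1 := by rw [hη']; linarith
  have hclamp : (clampProb η' : ℝ≥0∞) = ENNReal.ofReal η' := by
    rw [clampProb, min_eq_right (Real.toNNReal_le_one.2 hη1)]
    rfl
  have hsign : ev (biasedSign ρ) (fun η => ENNReal.ofReal (Real.exp (-(t * ((η : ℤˣ) : ℤ))))) ≤
      ENNReal.ofReal (1 - t * ρ + t ^ 2) := by
    rw [biasedSign, ev_map, ev_fintype]
    have huniv : (Finset.univ : Finset (ZMod 2)) = {0, 1} := by decide
    have hf : ∀ b : ZMod 2,
        ((fun η : ℤˣ => ENNReal.ofReal (Real.exp (-(t * ((η : ℤˣ) : ℤ))))) ∘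
          (fun b : ZMod 2 => if b = 1 then (-1 : ℤˣ) else 1)) b =
        if b = 1 then ENNReal.ofReal (Real.exp t) else ENNReal.ofReal (Real.exp (-t)) := by
      intro b
      by_cases hb : b = 1
      · subst hb
        simp
      · simp [hb]
    rw [huniv, Finset.sum_pair (by decide), bernoulliBit_apply_zero, bernoulliBit_apply_one, hf 0,
      hf 1, if_neg (by decide), if_pos rfl, ← hη', hclamp, ← ENNReal.ofReal_one,
      ← ENNReal.ofReal_sub _ hη0, ← ENNReal.ofReal_mul (by linarith),
      ← ENNReal.ofReal_mul hη0,
      ← ENNReal.ofReal_add (mul_nonneg (by linarith) (Real.exp_pos _).le)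
        (mul_nonneg hη0 (Real.exp_pos _).le)]
    refine ENNReal.ofReal_le_ofReal ?_
    have key := two_point_mgf_le (p := 1 - η') (p' := η') (t := t) (by linarith) hη0 (by ring) ht
    have hr : (1 - η') - η' = ρ := by rw [hη']; ring
    rw [hr] at key
    exact key
  rw [plantedConstraint, ev_bind]
  calc ev (PMF.uniformOfFintype (Scope n k)) (fun S => ev ((biasedSign ρ).map fun η =>
          (S, η * monomial z S.1)) fun c => ENNReal.ofReal (Real.exp (-(t * corrTerm z c))))
      = ev (PMF.uniformOfFintype (Scope n k)) (fun _ =>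
          ev (biasedSign ρ) fun η => ENNReal.ofReal (Real.exp (-(t * ((η : ℤˣ) : ℤ))))) := by
        congr 1
        funext S
        rw [ev_map]
        congr 1
        funext η
        simp only [Function.comp_apply, corrTerm_planted]
    _ = ev (biasedSign ρ) fun η => ENNReal.ofReal (Real.exp (-(t * ((η : ℤˣ) : ℤ)))) := ev_const _ _
    _ ≤ _ := hsign

end mgf

/-! ## Error bounds for the brute-force test -/

section errors

variable {n k : ℕ}

/-- The brute-force ("information-theoretic") test, as the SET of instances that look planted at
threshold `θ`: SOME assignment has correlation at least `θ` with the instance, i.e.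
`|𝓘| · Opt(𝓘) ≥ θ` (SOKB §1.2: "we could hypothetically succeed by detecting whether Opt ≈ 0 or
Opt ≈ ρ"). [cite: SchmidhuberEtAl2025, §1.2 and Def. 2.2 (Opt)] -/
def plantedLike (θ : ℝ) : Set (Instance n k) :=
  {I | ∃ x : Fin n → ℤˣ, θ ≤ corr x I}

/-- Membership in `plantedLike θ` (definitional unfolding). [folklore] -/
theorem mem_plantedLike {θ : ℝ} {I : Instance n k} :
    I ∈ plantedLike θ ↔ ∃ x : Fin n → ℤˣ, θ ≤ corr x I := Iff.rfl

/-- **Random instances rarely look planted (fixed number of constraints).** Union bound over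
the `2ⁿ` assignments and the Chernoff bound: for `0 ≤ t ≤ 1`,
`P_{𝓡_{n,k}(m)}[∃ x, corr x ≥ θ] ≤ 2ⁿ e^{-tθ} (1 + t²)^m`. [folklore] -/
theorem random_plantedLike_le (hkn : k ≤ n) (m : ℕ) (θ : ℝ) {t : ℝ} (ht0 : 0 ≤ t) (ht1 : t ≤ 1) :
    (random n k m).toOuterMeasure (plantedLike θ) ≤
      ENNReal.ofReal ((2 : ℝ) ^ n * (Real.exp (-(t * θ)) * (1 + t ^ 2) ^ m)) := by
  have ht : |t| ≤ 1 := abs_le.2 ⟨by linarith, ht1⟩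
  rw [random, dif_pos hkn]
  set q := uniformConstraint n k hkn
  have hU : (plantedLike (n := n) (k := k) θ) = ⋃ x : Fin n → ℤˣ, {I | θ ≤ corr x I} := by
    ext I
    simp [plantedLike]
  rw [hU]
  calc ((iidPMF q).map List.ofFn).toOuterMeasure (⋃ x : Fin n → ℤˣ, {I | θ ≤ corr x I})
      ≤ ∑ x : Fin n → ℤˣ, ((iidPMF q).map List.ofFn).toOuterMeasure {I | θ ≤ corr x I} :=
        measure_iUnion_fintype_le _ _
    _ ≤ ∑ _x : Fin n → ℤˣ, ENNReal.ofReal (Real.exp (-(t * θ)) * (1 + t ^ 2) ^ m) := by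
        refine Finset.sum_le_sum fun x _ => ?_
        rw [PMF.toOuterMeasure_map_apply]
        have hpre : List.ofFn ⁻¹' {I : Instance n k | θ ≤ corr x I} =
            {f : Fin m → Scope n k × ℤˣ | θ ≤ ∑ i, corrTerm x (f i)} := by
          ext f
          simp [corr_ofFn]
        rw [hpre]
        refine (iid_chernoff q m (corrTerm x) θ t ht0).trans ?_
        rw [ENNReal.ofReal_mul (Real.exp_pos _).le, ENNReal.ofReal_pow (by positivity)]
        gcongr
        exact ev_exp_uniformConstraint_le hkn x ht
    _ = ENNReal.ofReal ((2 : ℝ) ^ n * (Real.exp (-(t * θ)) * (1 + t ^ 2) ^ m)) := by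
        rw [Finset.sum_const, Finset.card_univ, Fintype.card_fun, Fintype.card_units_int,
          Fintype.card_fin, nsmul_eq_mul, ENNReal.ofReal_mul (by positivity : (0 : ℝ) ≤ 2 ^ n),
          ENNReal.ofReal_pow (by norm_num : (0 : ℝ) ≤ 2) n, ENNReal.ofReal_ofNat, Nat.cast_pow,
          Nat.cast_ofNat]

/-- **Planted instances correlate with their secret (fixed number of constraints).** Chernoff
bound for the lower tail: for `0 ≤ t ≤ 1` and `ρ ∈ [0,1]`,
`P_{𝓟^z_{n,k}(m,ρ)}[corr z < θ] ≤ e^{tθ} (1 - tρ + t²)^m`. [folklore] -/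
theorem planted_corr_lt_le (hkn : k ≤ n) (m : ℕ) {ρ : ℝ} (hρ0 : 0 ≤ ρ) (hρ1 : ρ ≤ 1)
    (z : Fin n → ℤˣ) (θ : ℝ) {t : ℝ} (ht0 : 0 ≤ t) (ht1 : t ≤ 1) :
    (planted n k m ρ z).toOuterMeasure {I | corr z I < θ} ≤
      ENNReal.ofReal (Real.exp (t * θ) * (1 - t * ρ + t ^ 2) ^ m) := by
  have ht : |t| ≤ 1 := abs_le.2 ⟨by linarith, ht1⟩
  have hM : 0 ≤ 1 - t * ρ + t ^ 2 := by nlinarith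
  rw [planted, dif_pos hkn, PMF.toOuterMeasure_map_apply]
  set q := plantedConstraint n k hkn ρ z
  have hsub : List.ofFn ⁻¹' {I : Instance n k | corr z I < θ} ⊆
      {f : Fin m → Scope n k × ℤˣ | -θ ≤ ∑ i, -corrTerm z (f i)} := by
    intro f hf
    simp only [Set.mem_preimage, Set.mem_setOf_eq, corr_ofFn] at hf
    simp only [Set.mem_setOf_eq, Finset.sum_neg_distrib]
    linarith
  refine (measure_mono hsub).trans
    ((iid_chernoff q m (fun c => -corrTerm z c) (-θ) t ht0).trans ?_)
  rw [mul_neg, neg_neg, ENNReal.ofReal_mul (Real.exp_pos _).le, ENNReal.ofReal_pow hM]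
  gcongr
  simpa only [mul_neg] using ev_exp_plantedConstraint_le hkn hρ0 hρ1 z ht

/-- **Random side, Poissonised.** `P_{𝓡̃_{n,k}(r)}[∃ x, corr x ≥ θ] ≤ 2ⁿ e^{-tθ} e^{r t²}`.
[folklore] -/
theorem poissonRandom_plantedLike_le (hkn : k ≤ n) (r : ℝ≥0) (θ : ℝ) {t : ℝ} (ht0 : 0 ≤ t)
    (ht1 : t ≤ 1) :
    (poissonRandom n k r).toOuterMeasure (plantedLike θ) ≤
      ENNReal.ofReal ((2 : ℝ) ^ n * Real.exp (-(t * θ)) * Real.exp (r * t ^ 2)) := by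
  rw [poissonRandom, PMF.toOuterMeasure_bind_apply]
  have h := poisson_mixture_le r (B := (2 : ℝ) ^ n * Real.exp (-(t * θ))) (M := 1 + t ^ 2)
    (by positivity) (by positivity) (fun m => (random n k m).toOuterMeasure (plantedLike θ))
    (fun m => by rw [mul_assoc]; exact random_plantedLike_le hkn m θ ht0 ht1)
  rwa [add_sub_cancel_left] at h

/-- **Planted side, Poissonised.** `P_{𝓟̃^z_{n,k}(r,ρ)}[corr z < θ] ≤ e^{tθ} e^{r (t² - tρ)}`.
[folklore] -/
theorem poissonPlanted_corr_lt_le (hkn : k ≤ n) (r : ℝ≥0) {ρ : ℝ} (hρ0 : 0 ≤ ρ) (hρ1 : ρ ≤ 1)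
    (z : Fin n → ℤˣ) (θ : ℝ) {t : ℝ} (ht0 : 0 ≤ t) (ht1 : t ≤ 1) :
    (poissonPlanted n k r ρ z).toOuterMeasure {I | corr z I < θ} ≤
      ENNReal.ofReal (Real.exp (t * θ) * Real.exp (r * (t ^ 2 - t * ρ))) := by
  have hM : 0 ≤ 1 - t * ρ + t ^ 2 := by
    have ht : |t| ≤ 1 := abs_le.2 ⟨by linarith, ht1⟩
    nlinarith
  rw [poissonPlanted, PMF.toOuterMeasure_bind_apply]
  have h := poisson_mixture_le r (B := Real.exp (t * θ)) (M := 1 - t * ρ + t ^ 2)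
    (Real.exp_pos _).le hM (fun m => (planted n k m ρ z).toOuterMeasure {I | corr z I < θ})
    (fun m => planted_corr_lt_le hkn m hρ0 hρ1 z θ ht0 ht1)
  have e : 1 - t * ρ + t ^ 2 - 1 = t ^ 2 - t * ρ := by ring
  rwa [e] at h

end errors

/-! ## Asymptotics: the error bounds vanish at the Kikuchi threshold density -/

section asymptotics

/-- If `r ≥ A · n · ln n` with `A > 0`, then `2ⁿ e^{-B r} → 0`: explicitly, it is `≤ δ` from some
`n₀` on. [folklore] -/
theorem eventually_two_pow_mul_exp_le {A B δ : ℝ} (hA : 0 < A) (hB : 0 < B) (hδ : 0 < δ) :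
    ∃ n₀ : ℕ, ∀ n : ℕ, n₀ ≤ n → ∀ r : ℝ, A * Real.log n * n ≤ r →
      (2 : ℝ) ^ n * Real.exp (-(B * r)) ≤ δ := by
  obtain ⟨N₁, hN₁⟩ := exists_nat_ge (Real.exp ((Real.log 2 + 1) / (A * B)))
  obtain ⟨N₂, hN₂⟩ := exists_nat_ge (-Real.log δ)
  refine ⟨max 1 (max N₁ N₂), fun n hn r hr => ?_⟩
  have hn1 : (1 : ℝ) ≤ n := by exact_mod_cast le_trans (le_max_left _ _) hn
  have hnN₁ : (N₁ : ℝ) ≤ n := by exact_mod_cast le_trans ((le_max_left _ _).trans (le_max_right _ _)) hn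
  have hnN₂ : (N₂ : ℝ) ≤ n := by exact_mod_cast le_trans ((le_max_right _ _).trans (le_max_right _ _)) hn
  have hlog : (Real.log 2 + 1) / (A * B) ≤ Real.log n := by
    rw [Real.le_log_iff_exp_le (by linarith)]
    exact hN₁.trans hnN₁
  have h1 : (Real.log 2 + 1) * n ≤ B * r := by
    have h' : Real.log 2 + 1 ≤ A * B * Real.log n := by
      have := (div_le_iff₀ (mul_pos hA hB)).1 hlog
      linarith
    calc (Real.log 2 + 1) * n ≤ (A * B * Real.log n) * n :=
          mul_le_mul_of_nonneg_right h' (by linarith)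
      _ = B * (A * Real.log n * n) := by ring
      _ ≤ B * r := mul_le_mul_of_nonneg_left hr hB.le
  have h2 : (2 : ℝ) ^ n = Real.exp (n * Real.log 2) := by
    rw [Real.exp_nat_mul, Real.exp_log (by norm_num)]
  rw [h2, ← Real.exp_add]
  calc Real.exp (n * Real.log 2 + -(B * r)) ≤ Real.exp (-(n : ℝ)) :=
        Real.exp_le_exp.2 (by nlinarith)
    _ ≤ δ := by
        rw [← Real.le_log_iff_exp_le hδ]
        linarith

variable {k : ℕ}

/-- The Kikuchi threshold mean is at least `A · ln n · n` for an explicit `A > 0` depending only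
on `k` and `κ`, once `n ≥ ℓ` and `n ≥ 1` (for `k ≥ 2`, where `(n/ℓ)^{(k-2)/2} ≥ 1`). [folklore] -/
theorem thresholdMean_ge {ℓ : ℕ} {κ : ℝ} (hκ : 0 < κ) (hk : 2 ≤ k) (hℓ : 0 < ℓ) {n : ℕ}
    (hnℓ : ℓ ≤ n) :
    2 * (1 + κ / (2 + κ)) * (1 + κ) / κ ^ 2 * ((k.choose (k / 2) : ℝ))⁻¹ * Real.log n * n ≤
      (thresholdMean k ℓ κ n : ℝ) := by
  have hn0 : (0 : ℝ) < n := by exact_mod_cast lt_of_lt_of_le hℓ hnℓ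
  have hℓ0 : (0 : ℝ) < ℓ := by exact_mod_cast hℓ
  rw [thresholdMean, Real.coe_toNNReal']
  refine le_trans ?_ (le_max_left _ _)
  rw [thresholdDensity, aliceConstant]
  have hpow : (1 : ℝ) ≤ ((n : ℝ) / ℓ) ^ (((k : ℝ) - 2) / 2) := by
    refine Real.one_le_rpow ?_ ?_
    · rw [le_div_iff₀ hℓ0, one_mul]
      exact_mod_cast hnℓ
    · have : (2 : ℝ) ≤ k := by exact_mod_cast hk
      linarith
  have hA : 0 ≤ 2 * (1 + κ / (2 + κ)) * (1 + κ) / κ ^ 2 * ((k.choose (k / 2) : ℝ))⁻¹ *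
      Real.log n := by
    have : 0 ≤ Real.log n := Real.log_nonneg (by exact_mod_cast lt_of_lt_of_le hℓ hnℓ)
    positivity
  calc 2 * (1 + κ / (2 + κ)) * (1 + κ) / κ ^ 2 * ((k.choose (k / 2) : ℝ))⁻¹ * Real.log n * n
      = (2 * (1 + κ / (2 + κ)) * (1 + κ) / κ ^ 2 * ((k.choose (k / 2) : ℝ))⁻¹ * Real.log n) * 1
          * n := by ring
    _ ≤ (2 * (1 + κ / (2 + κ)) * (1 + κ) / κ ^ 2 * ((k.choose (k / 2) : ℝ))⁻¹ * Real.log n) *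
          ((n : ℝ) / ℓ) ^ (((k : ℝ) - 2) / 2) * n := by
        gcongr

end asymptotics

/-! ## The one-qubit answer circuits -/

section circuits

/-- Bit flip of a one-qubit register label. [folklore] -/
def flipBits (x : QReg 1) : QReg 1 := fun i => !x i

/-- `flipBits` is an involution. [folklore] -/
theorem flipBits_involutive : Function.Involutive flipBits :=
  fun x => funext fun i => Bool.not_not (x i)

/-- Bit flip as a permutation of the one-qubit computational basis. [folklore] -/
def flipPerm : Equiv.Perm (QReg 1) :=
  Function.Involutive.toPerm _ flipBits_involutive

/-- The Pauli-`X` (NOT) gate as an element of the one-qubit unitary group: the permutation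
matrix of the bit flip (unitary by `permMatrix_mem_unitaryGroup`). (Nielsen–Chuang §1.3.1.)
[folklore] -/
def xGate : Matrix.unitaryGroup (QReg 1) ℂ :=
  ⟨flipPerm.permMatrix ℂ, permMatrix_mem_unitaryGroup _⟩

/-- The all-`false` label `|0⟩` of one qubit. [folklore] -/
abbrev zeroReg : QReg 1 := fun _ => false

/-- The all-`true` label `|1⟩` of one qubit. [folklore] -/
abbrev oneReg : QReg 1 := fun _ => true

/-- The ANSWER-`1` circuit: a single `X` gate on the unique wire (over `twoLocal`). [folklore] -/
def flipCircuit : QCircuit twoLocal 1 :=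
  ⟨[QGate.gate (Sum.inl xGate) (Function.Embedding.refl (Fin 1))]⟩

/-- The ANSWER-`0` circuit: the empty circuit on one wire. [folklore] -/
def idleCircuit : QCircuit twoLocal 1 := ⟨[]⟩

/-- `|1⟩` is accepted (wire `0` reads `true`). [folklore] -/
theorem oneReg_mem_acceptEvent : oneReg ∈ QCircuit.acceptEvent 1 := ⟨Nat.one_pos, rfl⟩

/-- `|0⟩` is rejected. [folklore] -/
theorem zeroReg_not_mem_acceptEvent : zeroReg ∉ QCircuit.acceptEvent 1 :=
  fun ⟨_, h⟩ => Bool.false_ne_true h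

/-- The flip permutation sends `|1⟩` to `|0⟩`. [folklore] -/
theorem flipPerm_oneReg : flipPerm oneReg = zeroReg := by
  funext i
  rfl

/-- Running the answer-`1` circuit on `|0⟩` gives amplitude `1` on `|1⟩`. [folklore] -/
theorem runOn_flipCircuit_oneReg : flipCircuit.runOn 0 (basisState zeroReg) oneReg = 1 := by
  rw [QCircuit.runOn, flipCircuit, QCircuit.toMatrix_cons, QCircuit.toMatrix_nil, one_mul,
    QGate.toMatrix_gate, basisState, Matrix.mulVec_single_one]
  show placeGate (Function.Embedding.refl (Fin 1)) (flipPerm.permMatrix ℂ) oneReg zeroReg = 1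
  rw [placeGate_apply, if_pos (fun i hi => (hi ⟨i, rfl⟩).elim)]
  show (flipPerm.permMatrix ℂ) oneReg zeroReg = 1
  rw [Equiv.Perm.permMatrix, PEquiv.toMatrix_toPEquiv_apply, flipPerm_oneReg, Pi.single_eq_same]

/-- The answer-`1` circuit reports `1` with probability (at least) `1`. [folklore] -/
theorem one_le_probEvent_flipCircuit :
    1 ≤ flipCircuit.probEvent 0 (basisState zeroReg) (QCircuit.acceptEvent 1) := by
  unfold QCircuit.probEvent
  have h1 : ‖flipCircuit.runOn 0 (basisState zeroReg) oneReg‖ ^ 2 = 1 := by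
    rw [runOn_flipCircuit_oneReg]
    simp
  calc (1 : ℝ) = ‖flipCircuit.runOn 0 (basisState zeroReg) oneReg‖ ^ 2 := h1.symm
    _ ≤ _ := by
        refine Finset.single_le_sum
          (f := fun y => ‖flipCircuit.runOn 0 (basisState zeroReg) y‖ ^ 2)
          (fun y _ => sq_nonneg _) ?_
        simp only [Finset.mem_filter, Finset.mem_univ, true_and]
        exact oneReg_mem_acceptEvent

/-- The answer-`0` circuit reports `0` with probability (at least) `1`. [folklore] -/
theorem one_le_probEvent_idleCircuit :
    1 ≤ idleCircuit.probEvent 0 (basisState zeroReg) (QCircuit.acceptEvent 1)ᶜ := by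
  unfold QCircuit.probEvent
  have h1 : ‖idleCircuit.runOn 0 (basisState zeroReg) zeroReg‖ ^ 2 = 1 := by
    rw [QCircuit.runOn, idleCircuit, QCircuit.toMatrix_nil, Matrix.one_mulVec, basisState_apply,
      if_pos rfl]
    simp
  calc (1 : ℝ) = ‖idleCircuit.runOn 0 (basisState zeroReg) zeroReg‖ ^ 2 := h1.symm
    _ ≤ _ := by
        refine Finset.single_le_sum
          (f := fun y => ‖idleCircuit.runOn 0 (basisState zeroReg) y‖ ^ 2)
          (fun y _ => sq_nonneg _) ?_
        simp only [Finset.mem_filter, Finset.mem_univ, true_and]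
        exact zeroReg_not_mem_acceptEvent

/-- The answer circuits have at most one gate. [folklore] -/
theorem size_flipCircuit : flipCircuit.size = 1 := rfl

/-- The empty circuit has no gates. [folklore] -/
theorem size_idleCircuit : idleCircuit.size = 0 := rfl

end circuits

/-! ## The (non-uniform) algorithm and the discharge of Theorem 4.18 as vendored -/

section assembly

variable {k n : ℕ}

/-- The algorithm family behind the discharge: NO classical seed, ONE qubit, and for the
instance `𝓘` the answer-`0` ("planted") circuit if some assignment has correlation `≥ θ` with
`𝓘` (`𝓘 ∈ plantedLike θ`, decided in the — unbounded — classical control that `QCircuitAlg`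
allows), else the answer-`1` ("random") circuit. [folklore] -/
def testAlg (k n : ℕ) (θ : ℝ) : QCircuitAlg (Instance n k) twoLocal where
  seeds := 0
  width _ _ := 1
  circ I _ := if I ∈ plantedLike θ then idleCircuit else flipCircuit

/-- The circuits of `testAlg` have at most one gate. [folklore] -/
theorem testAlg_size_le (θ : ℝ) (I : Instance n k) (r : Fin (testAlg k n θ).seeds → Bool) :
    (((testAlg k n θ).circ I r).size : ℝ) ≤ 1 := by
  show ((if I ∈ plantedLike θ then idleCircuit else flipCircuit).size : ℝ) ≤ 1
  split_ifs
  · rw [size_idleCircuit]; norm_num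
  · rw [size_flipCircuit]; norm_num

/-- The circuits of `testAlg` use one qubit. [folklore] -/
theorem testAlg_width (θ : ℝ) (I : Instance n k) (r : Fin (testAlg k n θ).seeds → Bool) :
    ((testAlg k n θ).width I r : ℝ) = 1 := by
  show ((1 : ℕ) : ℝ) = 1
  rw [Nat.cast_one]

/-- The seed-averaged probability of reporting `1` on the instance `𝓘`. [folklore] -/
theorem testAlg_outputOne (θ : ℝ) (I : Instance n k) :
    (∑ r, (testAlg k n θ).outputOneProb I r) / 2 ^ (testAlg k n θ).seeds =
      if I ∈ plantedLike θ then idleCircuit.probEvent 0 (basisState zeroReg) (QCircuit.acceptEvent 1)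
      else flipCircuit.probEvent 0 (basisState zeroReg) (QCircuit.acceptEvent 1) := by
  change (∑ r : Fin 0 → Bool, (testAlg k n θ).outputOneProb I r) / 2 ^ 0 = _
  rw [pow_zero, div_one, Fintype.sum_unique]
  change QCircuit.probEvent 0 (if I ∈ plantedLike θ then idleCircuit else flipCircuit)
    (basisState fun _ => false) (QCircuit.acceptEvent 1) = _
  split_ifs <;> rfl

/-- The seed-averaged probability of reporting `0` on the instance `𝓘`. [folklore] -/
theorem testAlg_outputZero (θ : ℝ) (I : Instance n k) :
    (∑ r, (testAlg k n θ).outputZeroProb I r) / 2 ^ (testAlg k n θ).seeds =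
      if I ∈ plantedLike θ then idleCircuit.probEvent 0 (basisState zeroReg) (QCircuit.acceptEvent 1)ᶜ
      else flipCircuit.probEvent 0 (basisState zeroReg) (QCircuit.acceptEvent 1)ᶜ := by
  change (∑ r : Fin 0 → Bool, (testAlg k n θ).outputZeroProb I r) / 2 ^ 0 = _
  rw [pow_zero, div_one, Fintype.sum_unique]
  change QCircuit.probEvent 0 (if I ∈ plantedLike θ then idleCircuit else flipCircuit)
    (basisState fun _ => false) (QCircuit.acceptEvent 1)ᶜ = _
  split_ifs <;> rfl

/-- `testAlg` reports `1` at least as often as the instance is NOT planted-like. [folklore] -/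
theorem testAlg_avgOutputOne_ge (θ : ℝ) (μ : PMF (Instance n k)) :
    1 - (μ.toOuterMeasure (plantedLike θ)).toReal ≤ (testAlg k n θ).avgOutputOne μ := by
  rw [← toReal_toOuterMeasure_compl]
  unfold QCircuitAlg.avgOutputOne
  simp_rw [testAlg_outputOne]
  refine toReal_toOuterMeasure_le_tsum μ (plantedLike θ)ᶜ _
    (max (idleCircuit.probEvent 0 (basisState zeroReg) (QCircuit.acceptEvent 1))
      (flipCircuit.probEvent 0 (basisState zeroReg) (QCircuit.acceptEvent 1)))
    (fun I => ?_) (fun I => ?_) (fun I hI => ?_)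
  · split_ifs <;> exact QCircuit.probEvent_nonneg _ _ _ _
  · split_ifs
    · exact le_max_left _ _
    · exact le_max_right _ _
  · have hI' : I ∉ plantedLike θ := hI
    rw [if_neg hI']
    exact one_le_probEvent_flipCircuit

/-- `testAlg` reports `0` at least as often as the instance IS planted-like. [folklore] -/
theorem testAlg_avgOutputZero_ge (θ : ℝ) (μ : PMF (Instance n k)) :
    (μ.toOuterMeasure (plantedLike θ)).toReal ≤ (testAlg k n θ).avgOutputZero μ := by
  unfold QCircuitAlg.avgOutputZero
  simp_rw [testAlg_outputZero]
  refine toReal_toOuterMeasure_le_tsum μ (plantedLike θ) _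
    (max (idleCircuit.probEvent 0 (basisState zeroReg) (QCircuit.acceptEvent 1)ᶜ)
      (flipCircuit.probEvent 0 (basisState zeroReg) (QCircuit.acceptEvent 1)ᶜ))
    (fun I => ?_) (fun I => ?_) (fun I hI => ?_)
  · split_ifs <;> exact QCircuit.probEvent_nonneg _ _ _ _
  · split_ifs
    · exact le_max_left _ _
    · exact le_max_right _ _
  · have hI' : I ∈ plantedLike θ := hI
    rw [if_pos hI']
    exact one_le_probEvent_idleCircuit

/-- If no assignment reaches correlation `θ`, then in particular the secret does not. [folklore] -/
theorem compl_plantedLike_subset (θ : ℝ) (z : Fin n → ℤˣ) :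
    (plantedLike (n := n) (k := k) θ)ᶜ ⊆ {I | corr z I < θ} := by
  intro I hI
  simp only [Set.mem_compl_iff, mem_plantedLike, not_exists, not_le] at hI
  exact hI z

/-- **Discharge of the named fact `SchmidhuberEtAl2025_thm418` (SOKB Theorem 4.18 as vendored).**

Proof route (a deliberately SHORTER road than the paper's, forced open by the vendored statement):
`HasQuantumSolver` quantifies over families of `QCircuitAlg`s whose circuit may depend on the
instance arbitrarily — no uniformity and no classical preprocessing bound are asserted (see the
docstrings of `HasQuantumSolver` and of the fact). The vendored special case of Thm. 4.18 therefore
follows from STATISTICAL distinguishability of `𝓡̃_{n,k}(m̄)` and `𝓟̃^z_{n,k}(m̄, ρ)` at the Kikuchi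
threshold mean `m̄(n) = C_κ (n/ℓ)^{(k-2)/2} · n ≥ A · n ln n ≫ n` (SOKB §1.1: "once `Δ > 1`, the
two distributions can be distinguished, although not necessarily in polynomial time"), by the
brute-force `Opt` test of §1.2/§2.1 ("we could hypothetically succeed by detecting whether
`Opt ≈ 0` or `Opt ≈ ρ`"): report "planted" iff some `x ∈ {±1}ⁿ` has `∑_{(S,b)} b x^S ≥ ρ m̄/2`.
Errors: random side `≤ 2ⁿ e^{-ρ² m̄/16}` (union bound over the `2ⁿ` assignments + the Chernoff
bound `iid_chernoff` with `t = ρ/4`, mixed over `m ∼ Poi(m̄)` by `poisson_mixture_le` — the paper's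
"standard Chernoff + union bound arguments", cf. Prop. 2.15), planted side `≤ e^{-ρ² m̄/16}`
(lower-tail Chernoff for `∑ ηᵢ`, Fact 2.5); both are `≤ 1 - σ` from some `n₀` on
(`eventually_two_pow_mul_exp_le`, using `m̄ ≥ A n ln n`, `thresholdMean_ge`). The answer is written
by a ONE-qubit circuit with at most ONE gate (`testAlg`: `X` for "random", nothing for "planted"),
so the gate bound holds with `C_g = 1, a_g = 0` and the qubit bound with `C_q = 1, a_q = 0`.
The quantum content of the printed theorem (guided sparse Hamiltonian phase estimation on the
Kikuchi matrix, Thms. 4.6–4.17) is thus not needed for the statement AS VENDORED; a consumer who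
wants it must state the solver with `HasUniformQuantumSolver` and an explicit preprocessing bound.
[cite: SchmidhuberEtAl2025, Thm. 4.18; §1.1 (statistical threshold `Δ > 1`), §1.2 and Def. 2.2 (`Opt`), Fact 2.5, Prop. 2.15 (Chernoff + union bound)] -/
theorem SchmidhuberEtAl2025_thm418_holds : SchmidhuberEtAl2025_thm418 := by
  intro k _hkeven hk ρ hρ0 hρ1
  refine ⟨1, 0, fun c hc => ⟨1, 0, ?_⟩⟩
  -- parameters
  set κ : ℝ := 0.99 * ρ with hκ
  have hκ0 : 0 < κ := by rw [hκ]; positivity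
  have hk0 : 0 < k := by omega
  have hℓ0 : 0 < c * k := Nat.mul_pos (by omega) hk0
  have hkℓ : k ≤ c * k := Nat.le_mul_of_pos_left k (by omega)
  set A : ℝ := 2 * (1 + κ / (2 + κ)) * (1 + κ) / κ ^ 2 * ((k.choose (k / 2) : ℝ))⁻¹ with hA
  have hA0 : 0 < A := by
    have : (0 : ℝ) < (k.choose (k / 2) : ℕ) := by exact_mod_cast Nat.choose_pos (Nat.div_le_self k 2)
    rw [hA]
    positivity
  have hmean : ∀ n : ℕ, c * k ≤ n → A * Real.log n * n ≤ (thresholdMean k (c * k) κ n : ℝ) :=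
    fun n hn => thresholdMean_ge hκ0 hk hℓ0 hn
  -- the test threshold `θ n = ρ m̄(n) / 2` and the Chernoff parameter `t = ρ / 4`
  set t : ℝ := ρ / 4 with ht
  have ht0 : 0 ≤ t := by rw [ht]; positivity
  have ht1 : t ≤ 1 := by rw [ht]; linarith
  refine ⟨fun n => testAlg k n (ρ * (thresholdMean k (c * k) κ n : ℝ) / 2), ?_, ?_⟩
  · -- resource bounds: one gate, one qubit
    obtain ⟨N₁, hN₁⟩ := exists_nat_ge (A⁻¹)
    obtain ⟨N₂, hN₂⟩ := exists_nat_ge (Real.exp 1)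
    refine ⟨max (max N₁ N₂) (max (c * k) 2), fun n hn I r => ⟨?_, ?_⟩⟩
    · have hnℓ : c * k ≤ n := le_trans ((le_max_left _ _).trans (le_max_right _ _)) hn
      have hn2 : 2 ≤ n := le_trans ((le_max_right _ _).trans (le_max_right _ _)) hn
      have hnN₁ : (N₁ : ℝ) ≤ n := by
        exact_mod_cast le_trans ((le_max_left _ _).trans (le_max_left _ _)) hn
      have hnN₂ : (N₂ : ℝ) ≤ n := by
        exact_mod_cast le_trans ((le_max_right _ _).trans (le_max_left _ _)) hn
      have hn1 : (1 : ℝ) ≤ n := by exact_mod_cast le_trans (by norm_num) hn2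
      have hlog : 1 ≤ Real.log n := by
        rw [Real.le_log_iff_exp_le (by linarith)]
        exact hN₂.trans hnN₂
      have hm1 : 1 ≤ (thresholdMean k (c * k) κ n : ℝ) := by
        refine le_trans ?_ (hmean n hnℓ)
        have hAn : 1 ≤ A * n := by
          have := mul_le_mul_of_nonneg_left (hN₁.trans hnN₁) hA0.le
          rwa [mul_inv_cancel₀ hA0.ne'] at this
        calc (1 : ℝ) ≤ A * n := hAn
          _ = A * 1 * n := by ring
          _ ≤ A * Real.log n * n := by gcongr
      refine (testAlg_size_le _ I r).trans ?_
      simp only [Nat.cast_one, one_mul, pow_zero, mul_one]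
      have hrpow : (1 : ℝ) ≤ (n : ℝ) ^ (((c * k : ℕ) : ℝ) / 4) :=
        Real.one_le_rpow hn1 (by positivity)
      nlinarith
    · have hn2 : 2 ≤ n := le_trans ((le_max_right _ _).trans (le_max_right _ _)) hn
      rw [testAlg_width]
      simp only [Nat.cast_one, one_mul, pow_zero, mul_one]
      have hlogb : 1 ≤ Real.logb 2 n := by
        rw [← Real.logb_self_eq_one (b := 2) (by norm_num)]
        exact Real.logb_le_logb_of_le (by norm_num) (by norm_num) (by exact_mod_cast hn2)
      have hℓ1 : (1 : ℝ) ≤ ((c * k : ℕ) : ℝ) := by exact_mod_cast hℓ0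
      nlinarith
  · -- correctness: both errors are at most `1 - σ` from some size on
    intro σ hσ
    obtain ⟨n₀, hn₀⟩ := eventually_two_pow_mul_exp_le hA0 (B := ρ ^ 2 / 16) (by positivity)
      (δ := 1 - σ) (by linarith)
    refine ⟨max n₀ (c * k), fun n hn => ?_⟩
    have hnn₀ : n₀ ≤ n := le_trans (le_max_left _ _) hn
    have hnℓ : c * k ≤ n := le_trans (le_max_right _ _) hn
    have hkn : k ≤ n := hkℓ.trans hnℓ
    set r : ℝ≥0 := thresholdMean k (c * k) κ n with hr
    have hbound : (2 : ℝ) ^ n * Real.exp (-(ρ ^ 2 / 16 * r)) ≤ 1 - σ := hn₀ n hnn₀ r (hmean n hnℓ)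
    have hθt : -(t * (ρ * r / 2)) + r * t ^ 2 = -(ρ ^ 2 / 16 * r) := by rw [ht]; ring
    have hθt' : t * (ρ * r / 2) + r * (t ^ 2 - t * ρ) = -(ρ ^ 2 / 16 * r) := by rw [ht]; ring
    constructor
    · -- random side
      have herr := poissonRandom_plantedLike_le hkn r (ρ * r / 2) ht0 ht1
      rw [mul_assoc, ← Real.exp_add, hθt] at herr
      have hreal : ((poissonRandom n k r).toOuterMeasure
          (plantedLike (ρ * r / 2))).toReal ≤ 1 - σ :=
        (ENNReal.toReal_le_of_le_ofReal (by positivity) herr).trans hbound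
      have := testAlg_avgOutputOne_ge (k := k) (ρ * r / 2) (poissonRandom n k r)
      linarith
    · -- planted side
      intro z
      have herr := poissonPlanted_corr_lt_le hkn r hρ0.le hρ1.le z (ρ * r / 2) ht0 ht1
      rw [← Real.exp_add, hθt'] at herr
      have hreal : ((poissonPlanted n k r ρ z).toOuterMeasure {I | corr z I < ρ * r / 2}).toReal ≤
          1 - σ := by
        refine (ENNReal.toReal_le_of_le_ofReal (by positivity) herr).trans (le_trans ?_ hbound)
        have h2n : (1 : ℝ) ≤ 2 ^ n := one_le_pow₀ (by norm_num)
        nlinarith [Real.exp_pos (-(ρ ^ 2 / 16 * r))]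
      have hcompl : ((poissonPlanted n k r ρ z).toOuterMeasure
          (plantedLike (ρ * r / 2))ᶜ).toReal ≤ 1 - σ :=
        (ENNReal.toReal_mono (ne_top_of_le_ne_top ENNReal.ofReal_ne_top herr)
          (measure_mono (compl_plantedLike_subset _ z))).trans hreal
      have hge := testAlg_avgOutputZero_ge (k := k) (ρ * r / 2) (poissonPlanted n k r ρ z)
      rw [← sub_sub_cancel 1 ((poissonPlanted n k r ρ z).toOuterMeasure
        (plantedLike (ρ * r / 2))).toReal, ← toReal_toOuterMeasure_compl] at hge
      linarith

end assembly

end KXOR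

end Literature.Computability.QuantumComplexity
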